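import Summits.AtomisticToContinuum.BoseEinsteinCondensation.Theorems.BECCellInformationCoarseChainRule
import HarnessLib

/-!
# Route `BECRieszReverseHolder`, crux `CoarseGrainedReverseHolder`
# (stmt-AtomisticToContinuum-12840), line `registered`: stub `stub_ae_ofReal_cubeFunctional_eq`

Supports (does not close) stmt-AtomisticToContinuum-12840; stub
`stub_ae_ofReal_cubeFunctional_eq` of the line `registered`
(`Cruxes/CoarseGrainedReverseHolder/Lines/registered.lean`).

**Bochner ↔ lower-integral identification of the cube functional of a trial-state slice.**
The crux's "cube functional" of the slice `x ↦ Ψ(x :: Y)` (tagged boson `x`, environment `Y`),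

  `M³ · (Σ_k (∫⁻_{cell k} ‖Ψ(x :: Y)‖₊²)²) / ∫⁻ ‖Ψ(z :: Y)‖₊²`,

is written with `[0,∞]`-valued lower integrals, while the sibling route `BECCellInformation` writes
the same cell masses as real Bochner integrals `A_k(Y) = ∫_{cell k} ‖Ψ(x :: Y)‖²` and slice mass
`w(Y) = ∫ ‖Ψ(z :: Y)‖²`. For almost every environment `Y` — namely those whose slice
`x ↦ ‖Ψ(x :: Y)‖²` is integrable, which is a.e. by Fubini since `∫∫ ‖Ψ‖² = 1`
(`CoarseChainRule.ae_integrable_normSq_vecCons`) — the two agree: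
`ofReal (M³ Σ_k A_k(Y)² / w(Y))` equals the `[0,∞]`-valued integrand.

Proof (elementary, Mathlib only). For an integrable slice, every lower integral is `ofReal` of the
corresponding Bochner integral (`ofReal_integral_eq_lintegral_ofReal` and the pointwise identity
`ofReal (‖u‖²) = ‖u‖₊²`). If `w(Y) > 0`, push `ofReal` through the quotient, the product, the cube,
the finite sum and the squares (everything is non-negative). If `w(Y) = 0`, every cell mass is
`≤ w(Y) = 0`, so both sides vanish (`x / 0 = 0` in `ℝ`, `0 / 0 = 0` in `[0,∞]`).

## References

* Mathlib `MeasureTheory.ofReal_integral_eq_lintegral_ofReal`, `MeasureTheory.setIntegral_le_integral`,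
  `ENNReal.ofReal_div_of_pos`, `ENNReal.ofReal_sum_of_nonneg` (folklore measure theory).
-/

open MeasureTheory
open scoped ENNReal NNReal BigOperators
open Literature.MathematicalPhysics.QuantumManyBody

namespace Summit.AtomisticToContinuum.BoseEinsteinCondensation.Theorems.CoarseGrainedReverseHolder

/-- Pointwise: `ofReal (‖u‖ ^ 2) = ‖u‖₊ ^ 2` in `[0,∞]`. -/
theorem ofReal_norm_sq_eq_nnnorm_sq {E : Type*} [SeminormedAddCommGroup E] (u : E) :
    ENNReal.ofReal (‖u‖ ^ 2) = (‖u‖₊ : ℝ≥0∞) ^ 2 := by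
  rw [ENNReal.ofReal_pow (norm_nonneg _), ofReal_norm, enorm_eq_nnnorm]

/-- If `x ↦ ‖f x‖ ^ 2` is integrable, then `∫⁻ ‖f‖₊ ^ 2 = ofReal (∫ ‖f‖ ^ 2)`. -/
theorem lintegral_nnnorm_sq_eq_ofReal_integral {α E : Type*} [MeasurableSpace α] {μ : Measure α}
    [NormedAddCommGroup E] {f : α → E} (hf : Integrable (fun x => ‖f x‖ ^ 2) μ) :
    ∫⁻ x, (‖f x‖₊ : ℝ≥0∞) ^ 2 ∂μ = ENNReal.ofReal (∫ x, ‖f x‖ ^ 2 ∂μ) := by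
  rw [ofReal_integral_eq_lintegral_ofReal hf (ae_of_all _ fun x => sq_nonneg _)]
  exact lintegral_congr fun x => (ofReal_norm_sq_eq_nnnorm_sq (f x)).symm

/-- **Abstract cube-functional identification.** For a finite family of sets `c k`, a natural
number `M` and a function `f` with `‖f‖ ^ 2` integrable,
`ofReal (M³ · Σ_k (∫_{c k} ‖f‖²)² / ∫ ‖f‖²) = M³ · (Σ_k (∫⁻_{c k} ‖f‖₊²)²) / ∫⁻ ‖f‖₊²` in `[0,∞]`
(both sides vanish when `∫ ‖f‖² = 0`). -/
theorem ofReal_cubeFunctional_eq_of_integrable {α E ι : Type*} [MeasurableSpace α]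
    {μ : Measure α} [NormedAddCommGroup E] [Fintype ι] (c : ι → Set α) {f : α → E}
    (hf : Integrable (fun x => ‖f x‖ ^ 2) μ) (M : ℕ) :
    ENNReal.ofReal ((M : ℝ) ^ 3 * (∑ k, (∫ x in c k, ‖f x‖ ^ 2 ∂μ) ^ 2) /
        ∫ z, ‖f z‖ ^ 2 ∂μ) =
      (M : ℝ≥0∞) ^ 3 * ((∑ k, (∫⁻ x in c k, (‖f x‖₊ : ℝ≥0∞) ^ 2 ∂μ) ^ 2) /
        ∫⁻ z, (‖f z‖₊ : ℝ≥0∞) ^ 2 ∂μ) := by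
  have hA : ∀ k, ∫⁻ x in c k, (‖f x‖₊ : ℝ≥0∞) ^ 2 ∂μ =
      ENNReal.ofReal (∫ x in c k, ‖f x‖ ^ 2 ∂μ) :=
    fun k => lintegral_nnnorm_sq_eq_ofReal_integral hf.integrableOn
  simp only [hA, lintegral_nnnorm_sq_eq_ofReal_integral hf]
  have hw0 : 0 ≤ ∫ z, ‖f z‖ ^ 2 ∂μ := integral_nonneg fun _ => sq_nonneg _
  rcases hw0.eq_or_lt with hw | hw
  · -- degenerate slice: every cell mass is `≤ 0`, both sides are `0`
    have hAk : ∀ k, ENNReal.ofReal (∫ x in c k, ‖f x‖ ^ 2 ∂μ) = 0 := fun k =>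
      ENNReal.ofReal_eq_zero.2
        (hw ▸ setIntegral_le_integral hf (ae_of_all _ fun _ => sq_nonneg _))
    simp [hAk, ← hw]
  · rw [ENNReal.ofReal_div_of_pos hw, ENNReal.ofReal_mul (pow_nonneg (Nat.cast_nonneg _) _),
      ENNReal.ofReal_pow (Nat.cast_nonneg _), ENNReal.ofReal_natCast,
      ENNReal.ofReal_sum_of_nonneg (fun k _ => sq_nonneg _), mul_div_assoc]
    congr 3 with k
    exact ENNReal.ofReal_pow (integral_nonneg fun _ => sq_nonneg _) 2

/-- **Bochner ↔ lintegral identification of the cube functional of a trial-state slice.** For a trial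
state `Ψ` of `n+1` bosons, `M` cells per axis of side `s`, for a.e. environment `Y` (those with an
integrable slice): `ofReal (M³ Σ_k A_k(Y)² / w(Y))`, with the REAL cell masses
`A_k(Y) = ∫_{cell k} ‖Ψ(x::Y)‖²` and slice mass `w(Y) = ∫ ‖Ψ(z::Y)‖²`, equals the `[0,∞]`-valued
integrand `M³ (Σ_k (∫⁻_{cell k} ‖Ψ(x::Y)‖₊²)²) / ∫⁻ ‖Ψ(z::Y)‖₊²` of the crux (`w(Y) = 0` forces every
`A_k(Y) = 0`: both sides vanish, `0/0 = 0` in both worlds). [folklore] -/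
theorem stub_ae_ofReal_cubeFunctional_eq {n : ℕ} {L : ℝ} (Ψ : BoseGas.TrialState (n + 1) L)
    (M : ℕ) (s : ℝ) :
    ∀ᵐ Y : BoseGas.Config n,
      ENNReal.ofReal ((M : ℝ) ^ 3 * (∑ k : Fin 3 → Fin M,
          (∫ x in {y : EuclideanSpace ℝ (Fin 3) | ∀ j, y j ∈
              Set.Ico (((k j : ℕ) : ℝ) * s) ((((k j : ℕ) : ℝ) + 1) * s)},
            ‖Ψ.ψ (Matrix.vecCons x Y)‖ ^ 2) ^ 2) / ∫ z, ‖Ψ.ψ (Matrix.vecCons z Y)‖ ^ 2) =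
        (M : ℝ≥0∞) ^ 3 * ((∑ k : Fin 3 → Fin M,
          (∫⁻ x in {y : EuclideanSpace ℝ (Fin 3) | ∀ j, y j ∈
              Set.Ico (((k j : ℕ) : ℝ) * s) ((((k j : ℕ) : ℝ) + 1) * s)},
            (‖Ψ.ψ (Matrix.vecCons x Y)‖₊ : ℝ≥0∞) ^ 2) ^ 2) /
          ∫⁻ z, (‖Ψ.ψ (Matrix.vecCons z Y)‖₊ : ℝ≥0∞) ^ 2) := by
  filter_upwards [CoarseChainRule.ae_integrable_normSq_vecCons Ψ] with Y hY
  exact ofReal_cubeFunctional_eq_of_integrable (f := fun x => Ψ.ψ (Matrix.vecCons x Y)) _ hY M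

end Summit.AtomisticToContinuum.BoseEinsteinCondensation.Theorems.CoarseGrainedReverseHolder
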